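import Summits.QuantumAdvantage.QuantumAdvantage.Theorems.InnerDegreeLawsA
import Summits.QuantumAdvantage.QuantumAdvantage.Theorems.AbsorptionDialB

set_option linter.dupNamespace false

/-!
# InnerDegreeLawsB (lens 4, g27; part B of 4) — LAW E (MOD_p hyperplanes XOR-span everything; the unconditional fibre-perfect edge), deletion identity, normal form

Blocker `X = AbsorptionDial.NoPerfectPolyOdd` (item 28487); decomp-qadv lens 4 (minimal-counterexample / extremal reduction), g27.  The NODE record
(rung `QuadFormNoPerfectOdd`, residual `QuadLiftOdd`, sub-rung `OneQuadNoPerfectOdd`, floor `linFormFloor`, `x_iff_pieces`) lives in the cell file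
`g27/InnerDegreeDial.lean` and is NOT landed (Prop-definition node pieces); the tree parts are Prop-definition-free and state only unconditional LAWS.
Kernel-checked content:

* §4 **LAW E (`xorSpan_hyperplanes`, `fibrePerfect_unconditional`).**  For `p` odd the `MOD_p`-hyperplane indicators
  `u ↦ [Σ_i λ_i u_i ≡ r]` XOR-span ALL Boolean functions on `ℓ` bits (`2^ℓ(p^ℓ+1)` of them suffice, uniformly); plugged into the landed
  `AbsorptionDial.fibrePerfect_of_xorRep` this makes the g14 edge UNCONDITIONAL: for every `ℓ` a cut-degree-`(p−1)` strategy on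
  `3·2^ℓ(p^ℓ+1)+ℓ` bits wins on a whole `ℓ`-dimensional fibre.  Consequence (NODE-g27 §3): every AGGREGATE normal form of `X`
  (sparse sub-board, frozen-context window, per-charge parity) is vacuous for `p` odd at degree `≥ p − 1`.
* §10 the **deletion identity** `ringWinU_silence` / `perfect_iff_lossSet` (perfection ⟺ the loss set of the strategy with one register
  silenced is exactly that register's live firing set).
* the lens-4 **normal form** `perfect_spread` (contrapositive of LAW C): a perfect strategy is `k`-form on NO large subcube.
-/

open Finset
open Summit.QuantumAdvantage.AdviceFreeQNC0

namespace Summit.QuantumAdvantage.QuantumAdvantage.Theorems.InnerDegreeDial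

/-! ### §4 LAW E: `MOD_p` hyperplane indicators XOR-span every Boolean function (`p` odd); the unconditional edge -/

section LawE

variable {p : ℕ} [Fact p.Prime] {ℓ : ℕ}

/-- the linear form `Σ_i [x i] λ_i (mod p)`, as a function of the coefficient vector `λ` at the Boolean point `x` -/
def formAt (x : Fin ℓ → Bool) (lam : Fin ℓ → ZMod p) : ZMod p := ∑ i, if x i then lam i else 0

/-- the `MOD_p` hyperplane indicator `u ↦ [Σ_i λ_i u_i ≡ r]` — an `𝔽_p`-degree-`(p−1)` Boolean function (tree: `hasDegF_linTest`,
`AdviceFreeQNC0/LinearSelections.lean`; definitionally the same shape) -/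
def hyp (lam : Fin ℓ → ZMod p) (r : ZMod p) : (Fin ℓ → Bool) → Bool :=
  fun u => decide ((∑ i, (if u i then lam i else 0)) = r)

/-- unfolding the hyperplane indicator `hyp` -/
theorem hyp_eq_true (lam : Fin ℓ → ZMod p) (r : ZMod p) (u : Fin ℓ → Bool) :
    hyp lam r u = true ↔ formAt u lam = r := by
  simp [hyp, formAt]

/-- `formAt` is additive in the coefficient vector -/
theorem formAt_add (x : Fin ℓ → Bool) (lam μ : Fin ℓ → ZMod p) : formAt x (lam + μ) = formAt x lam + formAt x μ := by
  unfold formAt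
  rw [← sum_add_distrib]
  refine sum_congr rfl fun i _ => ?_
  by_cases h : x i = true <;> simp [h]

/-- `formAt` of a coefficient vector supported on one `true` coordinate -/
theorem formAt_single (x : Fin ℓ → Bool) (i₀ : Fin ℓ) (hx : x i₀ = true) (a : ZMod p) :
    formAt x (Pi.single i₀ a) = a := by
  classical
  unfold formAt
  rw [Finset.sum_eq_single i₀]
  · simp [hx]
  · intro i _ hi
    simp [Pi.single_eq_of_ne hi]
  · simp

/-- all level sets of a form with a live coordinate have the same size (translate along that coordinate) -/
theorem card_formAt_level (x : Fin ℓ → Bool) {i₀ : Fin ℓ} (hx : x i₀ = true) (r r' : ZMod p) :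
    (univ.filter fun lam : Fin ℓ → ZMod p => formAt x lam = r).card
      = (univ.filter fun lam : Fin ℓ → ZMod p => formAt x lam = r').card := by
  classical
  refine Finset.card_equiv (Equiv.addRight (Pi.single i₀ (r' - r))) fun lam => ?_
  simp only [mem_filter, mem_univ, true_and, Equiv.coe_addRight]
  rw [formAt_add, formAt_single x i₀ hx]
  constructor
  · intro h; rw [h]; ring
  · intro h
    have : formAt x lam = formAt x lam + (r' - r) - (r' - r) := by ring
    rw [this, h]; ring

/-- the number of coefficient vectors on which a form with a live coordinate takes the value `1` is ODD (`= p^(ℓ−1)`, `p` odd) -/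
theorem card_formAt_one_odd (hp2 : p ≠ 2) (x : Fin ℓ → Bool) {i₀ : Fin ℓ} (hx : x i₀ = true) :
    (univ.filter fun lam : Fin ℓ → ZMod p => formAt x lam = 1).card % 2 = 1 := by
  classical
  set N := (univ.filter fun lam : Fin ℓ → ZMod p => formAt x lam = 1).card with hN
  have htot : (univ : Finset (Fin ℓ → ZMod p)).card
      = ∑ r : ZMod p, (univ.filter fun lam : Fin ℓ → ZMod p => formAt x lam = r).card :=
    card_eq_sum_card_fiberwise (f := formAt x) (t := univ) fun _ _ => mem_univ _
  have hconst : ∑ r : ZMod p, (univ.filter fun lam : Fin ℓ → ZMod p => formAt x lam = r).card = ∑ _r : ZMod p, N := by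
    refine sum_congr rfl fun r _ => ?_
    rw [hN]; exact card_formAt_level x hx r 1
  have hsum : ∑ _r : ZMod p, N = p * N := by rw [sum_const, card_univ, ZMod.card, smul_eq_mul]
  have hcard : (univ : Finset (Fin ℓ → ZMod p)).card = p ^ ℓ := by
    rw [card_univ, Fintype.card_fun, ZMod.card, Fintype.card_fin]
  rw [hconst, hsum, hcard] at htot
  have hodd : Odd (p ^ ℓ) := Odd.pow ((Fact.out : p.Prime).odd_of_ne_two hp2)
  rw [htot] at hodd
  exact Nat.odd_iff.mp (Nat.odd_mul.mp hodd).2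

/-- … and is ZERO for the dead point `x = 0` -/
theorem card_formAt_one_zero (x : Fin ℓ → Bool) (hx : ∀ i, x i = false) :
    (univ.filter fun lam : Fin ℓ → ZMod p => formAt x lam = 1).card = 0 := by
  rw [card_eq_zero, filter_eq_empty_iff]
  intro lam _
  have : formAt x lam = 0 := by
    unfold formAt; exact sum_eq_zero fun i _ => by simp [hx i]
  rw [this]; exact zero_ne_one

/-- parity form: `#{λ : form_x(λ) = 1} ≡ [x ≠ 0] (mod 2)` -/
theorem card_formAt_one_mod_two (hp2 : p ≠ 2) (x : Fin ℓ → Bool) :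
    (univ.filter fun lam : Fin ℓ → ZMod p => formAt x lam = 1).card % 2 = if ∃ i, x i = true then 1 else 0 := by
  split_ifs with h
  · obtain ⟨i₀, hx⟩ := h
    exact card_formAt_one_odd hp2 x hx
  · push Not at h
    rw [card_formAt_one_zero x fun i => by simpa using h i]

/-- twisting the coefficients by `v`: `Σ_i [u_i] λ'_i + Σ_{i : v_i} λ_i = Σ_i [u_i ≠ v_i] λ_i` with `λ'_i = ∓λ_i` -/
def twist (v : Fin ℓ → Bool) (lam : Fin ℓ → ZMod p) : Fin ℓ → ZMod p := fun i => if v i then -lam i else lam i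

/-- the shift `Σ_{i : v_i} λ_i` -/
def shift (v : Fin ℓ → Bool) (lam : Fin ℓ → ZMod p) : ZMod p := ∑ i, if v i then lam i else 0

/-- the form at `u` with coefficients twisted along `v` -/
theorem formAt_twist (u v : Fin ℓ → Bool) (lam : Fin ℓ → ZMod p) :
    formAt u (twist v lam) + shift v lam = formAt (fun i => (u i != v i)) lam := by
  unfold formAt twist shift
  rw [← sum_add_distrib]
  refine sum_congr rfl fun i _ => ?_
  cases hu : u i <;> cases hv : v i <;> simp [hu, hv]

/-- the translated hyperplane `[form_{u ⊕ v}(λ) = 1]` as a hyperplane indicator in `u` -/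
theorem hyp_twist_eq_true (u v : Fin ℓ → Bool) (lam : Fin ℓ → ZMod p) :
    hyp (twist v lam) (1 - shift v lam) u = true ↔ formAt (fun i => (u i != v i)) lam = 1 := by
  rw [hyp_eq_true, ← formAt_twist]
  constructor
  · intro h; rw [h]; ring
  · intro h
    have : formAt u (twist v lam) = formAt u (twist v lam) + shift v lam - shift v lam := by ring
    rw [this, h]

/-- the uniform index type of the representing family: a point `v` of the cube and either the constant or a coefficient vector -/
abbrev Idx (p ℓ : ℕ) := (Fin ℓ → Bool) × Option (Fin ℓ → ZMod p)

/-- **the representing family** of a Boolean function `f`: for `v ∈ supp f`, the constant `1 = [0 ≡ 0]` and all translated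
hyperplanes `[form_{u⊕v}(λ) ≡ 1]`; for `v ∉ supp f`, the empty hyperplane `[0 ≡ 1]`.  Every member is a hyperplane indicator. -/
def fam (f : (Fin ℓ → Bool) → Bool) : Idx p ℓ → (Fin ℓ → Bool) → Bool
  | (v, none) => if f v then hyp (0 : Fin ℓ → ZMod p) 0 else hyp (0 : Fin ℓ → ZMod p) 1
  | (v, some lam) => if f v then hyp (twist v lam) (1 - shift v lam) else hyp (0 : Fin ℓ → ZMod p) 1

/-- every member of the hyperplane family has degree `≤ p − 1` -/
theorem hasDegF_fam (f : (Fin ℓ → Bool) → Bool) (ι : Idx p ℓ) : HasDegF p (fam f ι) (p - 1) := by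
  rcases ι with ⟨v, _ | lam⟩ <;> simp only [fam] <;> split_ifs <;> exact hasDegF_linTest _ _

/-- the degenerate hyperplane `0 ≡ 0` is everywhere `true` -/
theorem hyp_zero_zero (u : Fin ℓ → Bool) : hyp (0 : Fin ℓ → ZMod p) 0 u = true := by
  simp [hyp]

/-- the degenerate hyperplane `0 ≡ 1` is everywhere `false` -/
theorem hyp_zero_one (u : Fin ℓ → Bool) : hyp (0 : Fin ℓ → ZMod p) 1 u = false := by
  rw [Bool.eq_false_iff, ne_eq, hyp_eq_true]
  have : formAt u (0 : Fin ℓ → ZMod p) = 0 := by unfold formAt; exact sum_eq_zero fun i _ => by simp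
  rw [this]; exact zero_ne_one

/-- the fibre over `v` of the fire count: `[f v]·(1 + #{λ : form_{u⊕v}(λ) = 1})` -/
theorem sum_fam_fibre (f : (Fin ℓ → Bool) → Bool) (v u : Fin ℓ → Bool) :
    (∑ o : Option (Fin ℓ → ZMod p), if fam f (v, o) u = true then 1 else 0 : ℕ)
      = if f v = true then 1 + (univ.filter fun lam : Fin ℓ → ZMod p => formAt (fun i => (u i != v i)) lam = 1).card else 0 := by
  classical
  rw [Fintype.sum_option]
  by_cases hf : f v = true
  · simp only [fam, hf, if_true, hyp_zero_zero, if_true]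
    congr 1
    rw [card_eq_sum_ones, sum_filter]
    refine sum_congr rfl fun lam _ => ?_
    by_cases h : hyp (twist v lam) (1 - shift v lam) u = true
    · rw [if_pos h, if_pos ((hyp_twist_eq_true u v lam).mp h)]
    · rw [if_neg h, if_neg (fun h' => h ((hyp_twist_eq_true u v lam).mpr h'))]
  · simp [fam, hf, hyp_zero_one]

/-- two bit vectors differ iff some coordinate differs (Boolean form) -/
theorem ne_iff_exists_bne (u v : Fin ℓ → Bool) : (∃ i, (u i != v i) = true) ↔ u ≠ v := by
  constructor
  · rintro ⟨i, hi⟩ h; rw [h] at hi; simp at hi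
  · intro h
    by_contra hall
    push Not at hall
    exact h (funext fun i => by have := hall i; cases hu : u i <;> cases hv : v i <;> simp_all)

/-- **LAW E (XOR-completeness of `MOD_p` hyperplanes, `p` odd).**  The family `fam f` — `2^ℓ·(p^ℓ+1)` hyperplane indicators —
has fire-count parity EXACTLY `f`: every Boolean function on `ℓ` bits is an XOR of `MOD_p` hyperplane indicators. -/
theorem xorSpan_hyperplanes (hp2 : p ≠ 2) (f : (Fin ℓ → Bool) → Bool) (u : Fin ℓ → Bool) :
    (univ.filter fun ι : Idx p ℓ => fam f ι u = true).card % 2 = if f u = true then 1 else 0 := by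
  classical
  rw [card_eq_sum_ones, sum_filter, Fintype.sum_prod_type]
  simp_rw [sum_fam_fibre]
  rw [Finset.sum_nat_mod]
  have hterm : ∀ v : Fin ℓ → Bool,
      (if f v = true then 1 + (univ.filter fun lam : Fin ℓ → ZMod p => formAt (fun i => (u i != v i)) lam = 1).card else 0) % 2
        = if v = u then (if f u = true then 1 else 0) else 0 := by
    intro v
    by_cases hf : f v = true
    · rw [if_pos hf, Nat.add_mod, card_formAt_one_mod_two hp2]
      by_cases hvu : v = u
      · subst hvu
        simp [hf]
      · have hex : ∃ i, (u i != v i) = true := (ne_iff_exists_bne u v).mpr (Ne.symm hvu)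
        rw [if_pos hex, if_neg hvu]
    · rw [if_neg hf]
      by_cases hvu : v = u
      · subst hvu; simp [hf]
      · rw [if_neg hvu]
  simp_rw [hterm]
  rw [sum_ite_eq' univ u, if_pos (mem_univ u)]
  split_ifs <;> simp

/-! #### The unconditional edge: a degree-`(p−1)` strategy perfect on a whole `ℓ`-dimensional fibre -/

/-- re-indexing the three residue classes of `Fin (3s)` by `Fin s` -/
theorem card_class_eq {s : ℕ} (ρ : ℕ) (hρ : ρ < 3) (P : Fin s → Prop) [DecidablePred P] :
    (univ.filter fun i : Fin (3 * s) => i.val % 3 = ρ ∧ P ⟨i.val / 3, by omega⟩).card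
      = (univ.filter fun j : Fin s => P j).card := by
  refine (card_bij' (fun i _ => ⟨i.val / 3, by omega⟩) (fun j _ => ⟨3 * j.val + ρ, by omega⟩) ?_ ?_ ?_ ?_)
  · intro i hi
    rw [mem_filter] at hi ⊢
    exact ⟨mem_univ _, hi.2.2⟩
  · intro j hj
    rw [mem_filter] at hj ⊢
    refine ⟨mem_univ _, by show (3 * j.val + ρ) % 3 = ρ; omega, ?_⟩
    have : (⟨(3 * j.val + ρ) / 3, by omega⟩ : Fin s) = j := by ext; simp; omega
    rw [this]; exact hj.2
  · intro i hi
    rw [mem_filter] at hi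
    ext; simp; omega
  · intro j _
    ext; simp; omega

/-- the three targets of the edge: `w ↦ [|w| ≡ 2ρ+1 (mod 3)]` -/
def target (ℓ : ℕ) (ρ : ℕ) : (Fin ℓ → Bool) → Bool := fun w => decide (wt w % 3 = (2 * ρ + 1) % 3)

/-- the edge table: class `ρ = i % 3`, member `e (i / 3)` of the representing family of `target ρ` -/
def edgeTable (ℓ : ℕ) (e : Fin (Fintype.card (Idx p ℓ)) ≃ Idx p ℓ) :
    Fin (3 * Fintype.card (Idx p ℓ)) → (Fin ℓ → Bool) → Bool :=
  fun i => fam (target ℓ (i.val % 3)) (e ⟨i.val / 3, by omega⟩)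

/-- parity bookkeeping for the indexed hyperplane table -/
theorem edgeTable_parity (hp2 : p ≠ 2) (e : Fin (Fintype.card (Idx p ℓ)) ≃ Idx p ℓ) (ρ : ℕ) (hρ : ρ < 3)
    (w : Fin ℓ → Bool) :
    (univ.filter fun i : Fin (3 * Fintype.card (Idx p ℓ)) => i.val % 3 = ρ ∧ edgeTable ℓ e i w = true).card % 2
      = if wt w % 3 = (2 * ρ + 1) % 3 then 1 else 0 := by
  classical
  have h1 : (univ.filter fun i : Fin (3 * Fintype.card (Idx p ℓ)) => i.val % 3 = ρ ∧ edgeTable ℓ e i w = true)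
      = (univ.filter fun i : Fin (3 * Fintype.card (Idx p ℓ)) =>
          i.val % 3 = ρ ∧ fam (target ℓ ρ) (e ⟨i.val / 3, by omega⟩) w = true) := by
    refine filter_congr fun i _ => ?_
    constructor
    · rintro ⟨h, h'⟩; refine ⟨h, ?_⟩; simpa [edgeTable, h] using h'
    · rintro ⟨h, h'⟩; refine ⟨h, ?_⟩; simpa [edgeTable, h] using h'
  rw [h1, card_class_eq ρ hρ (fun j => fam (target ℓ ρ) (e j) w = true)]
  have h2 : (univ.filter fun j : Fin (Fintype.card (Idx p ℓ)) => fam (target ℓ ρ) (e j) w = true).card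
      = (univ.filter fun ι : Idx p ℓ => fam (target ℓ ρ) ι w = true).card := by
    refine card_equiv e fun j => ?_
    simp
  rw [h2, xorSpan_hyperplanes hp2]
  simp [target]

/-- **LAW E′ (the unconditional edge).**  For every odd prime `p` and every `ℓ`: with `s = 2^ℓ·(p^ℓ + 1)` there are a charge,
a strategy on `3s + ℓ` bits ALL of whose registers have `𝔽_p`-degree `≤ p − 1`, and a frozen prefix `a ∈ {0,1}^{3s}` such that the
strategy wins the u-walk game at EVERY point of the fibre `a ++ {0,1}^ℓ` (the g14 edge `fibrePerfect_of_xorRep` with its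
representation hypothesis discharged by `xorSpan_hyperplanes`).  Fibre dimension `ℓ ≈ log_{2p}(board length)`. -/
theorem fibrePerfect_unconditional (hp2 : p ≠ 2) (ℓ : ℕ) :
    ∃ (c : ℕ) (y : Fin (3 * Fintype.card (Idx p ℓ) + ℓ + 1) → (Fin (3 * Fintype.card (Idx p ℓ) + ℓ) → Bool) → Bool)
      (a : Fin (3 * Fintype.card (Idx p ℓ)) → Bool),
      (∀ g, HasDegF p (y g) (p - 1)) ∧ ∀ w : Fin ℓ → Bool, ringWinU c y (Fin.append a w) = true := by
  classical
  let e : Fin (Fintype.card (Idx p ℓ)) ≃ Idx p ℓ := (Fintype.equivFin (Idx p ℓ)).symm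
  exact AbsorptionDial.fibrePerfect_of_xorRep (F := edgeTable ℓ e) (fun i => hasDegF_fam _ _)
    (fun ρ hρ w => edgeTable_parity hp2 e ρ hρ w)

/-- the size of the index type: `2^ℓ · (p^ℓ + 1)` -/
theorem card_idx (ℓ : ℕ) : Fintype.card (Idx p ℓ) = 2 ^ ℓ * (p ^ ℓ + 1) := by
  rw [Fintype.card_prod, Fintype.card_option, Fintype.card_fun, Fintype.card_fun, Fintype.card_bool, ZMod.card,
    Fintype.card_fin]

end LawE

/-! ### §10 the deletion identity and the minimal suspect (c0): one quadratic register on top of a `k`-form strategy -/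

section Deletion

variable {n : ℕ}

/-- liveness of cut `g` at input `u` for charge `c` (the walk exponent is `≢ 0 (mod 3)`) -/
def liveCut (c : ℕ) (u : Fin n → Bool) (g : Fin (n + 1)) : Bool := decide ((c + g.val + walkExp u g.val) % 3 ≠ 0)

/-- the strategy with register `g₀` silenced -/
def silence (y : Fin (n + 1) → (Fin n → Bool) → Bool) (g₀ : Fin (n + 1)) : Fin (n + 1) → (Fin n → Bool) → Bool :=
  Function.update y g₀ (fun _ => false)

/-- the live-firing filter of the silenced strategy is the original one with `g₀` erased -/
theorem filter_silence (c : ℕ) (y : Fin (n + 1) → (Fin n → Bool) → Bool) (g₀ : Fin (n + 1)) (u : Fin n → Bool) :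
    (univ.filter fun g : Fin (n + 1) => silence y g₀ g u = true ∧ (c + g.val + walkExp u g.val) % 3 ≠ 0)
      = (univ.filter fun g : Fin (n + 1) => y g u = true ∧ (c + g.val + walkExp u g.val) % 3 ≠ 0).erase g₀ := by
  ext g
  simp only [mem_filter, mem_univ, true_and, mem_erase]
  unfold silence
  by_cases hg : g = g₀
  · subst hg
    simp
  · simp [hg]

/-- **deletion identity:** the win bit is the win bit of the strategy with register `g₀` silenced, XOR `[y g₀ fires ∧ g₀ live]` -/
theorem ringWinU_silence (c : ℕ) (y : Fin (n + 1) → (Fin n → Bool) → Bool) (g₀ : Fin (n + 1)) (u : Fin n → Bool) :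
    ringWinU c y u = xor (ringWinU c (silence y g₀) u) (y g₀ u && liveCut c u g₀) := by
  classical
  unfold ringWinU
  rw [filter_silence]
  set S := univ.filter (fun g : Fin (n + 1) => y g u = true ∧ (c + g.val + walkExp u g.val) % 3 ≠ 0) with hS
  by_cases hmem : g₀ ∈ S
  · have hcard : (S.erase g₀).card + 1 = S.card := card_erase_add_one hmem
    have hb : (y g₀ u && liveCut c u g₀) = true := by
      rw [hS, mem_filter] at hmem
      unfold liveCut
      simp [hmem.2.1, hmem.2.2]
    rw [hb, Bool.xor_true, ← hcard]
    rcases Nat.mod_two_eq_zero_or_one (S.erase g₀).card with h | h <;> simp [Nat.add_mod, h]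
  · have hb : (y g₀ u && liveCut c u g₀) = false := by
      rw [hS, mem_filter] at hmem
      unfold liveCut
      by_cases hy : y g₀ u = true
      · have : ¬ ((c + g₀.val + walkExp u g₀.val) % 3 ≠ 0) := fun hl => hmem ⟨mem_univ _, hy, hl⟩
        simp [hy, this]
      · simp [hy]
    rw [erase_eq_of_notMem hmem, hb, Bool.xor_false]

/-- **perfection ⟺ the loss set of the silenced strategy is exactly the live firing set of the deleted register** -/
theorem perfect_iff_lossSet (c : ℕ) (y : Fin (n + 1) → (Fin n → Bool) → Bool) (g₀ : Fin (n + 1)) :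
    (∀ u, ringWinU c y u = true) ↔ ∀ u, ringWinU c (silence y g₀) u = !(y g₀ u && liveCut c u g₀) := by
  refine forall_congr' fun u => ?_
  rw [ringWinU_silence c y g₀ u]
  cases ringWinU c (silence y g₀) u <;> cases (y g₀ u && liveCut c u g₀) <;> simp

end Deletion

/-! ### the lens-4 normal form -/

section NormalForm

/-- **the lens-4 normal form (contrapositive of LAW C):** a PERFECT strategy is `k`-form on NO subcube past the threshold — every
counterexample to X is spread. -/
theorem perfect_spread {p : ℕ} [Fact p.Prime] (hp5 : 5 ≤ p) {n m k : ℕ}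
    (hcount : (n + 1) * (p ^ k * 2) * (2 * p - 1) ^ m < (2 * p) ^ m) (c : ℕ)
    (y : Fin (n + 1) → (Fin n → Bool) → Bool) (hperf : ∀ u, ringWinU c y u = true)
    (ρ : Fin n → Bool) (T : Fin m ↪ Fin n)
    (lam : Fin (n + 1) → Fin k → Fin m → ZMod p) (F : Fin (n + 1) → (Fin k → ZMod p) → Bool) :
    ¬ (∀ g v, y g (fill ρ T v) = F g (fun j => ∑ i, if v i = true then lam g j i else 0)) := by
  intro hy
  obtain ⟨v, hv⟩ := loss_on_kForm_subcube hp5 hcount c y ρ T lam F hy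
  rw [hperf] at hv
  exact Bool.noConfusion hv

end NormalForm

end Summit.QuantumAdvantage.QuantumAdvantage.Theorems.InnerDegreeDial
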